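import Summits.Ventures.AbcShadow.SH02.RowD73Kernel

/-!
# Venture AbcShadow — SH-02: the TRANSCRIBED kill-prime record itself holds (kernel)

HONEST FRAMING. Certificate file of the work-bound cell `abc-shadow` (typer seat `abc-shadow-typ-2`); no Diophantine
statement beyond what `SH02/RowD73Kernel.lean` already derives, no claim on abc or on any summit, no side on IUT.
`SH02/KillData.lean` transcribed the cell's COMPUTED record as the hypotheses `KillData7841`
(`a_7841(2336a1) = a_7841(2336b1) = −158`, `S_7841 ⊆ {t even, |t| ≤ 176} ∖ {−158}`) and `KillData41189` (`−284`,
`S_41189 ⊆ {t even, |t| ≤ 404} ∖ {−284}`). Here both are PROVED: the traces and `c ∉ S_ℓ` by the kernel runs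
(`killCert_7841`, `killCert_41189`), `|t| ≤ 2√ℓ` by the tree's proved Hasse theorem (`apTrace_sq_le`), and evenness
because every `G_{w,v} : Y² = X³ + 2wX² + bX` has the rational `2`-torsion point `(0, 0)`, so `2 ∣ #G_{w,v}(𝔽_ℓ)`
(Mathlib `addOrderOf_dvd_natCard`) and `a = ℓ + 1 − #G` is even for odd `ℓ` (then `|t| ≤ 177` sharpens to `176`,
`405` to `404`). So the record (inv-6 K4-73/73bis, crit-1 j319553, third path 97fd313139c017bc, eng-2 j320506) is
confirmed inside the Lean kernel in exactly the transcribed form, and `sh02_d73_of_data M hP killData_7841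
killData_41189` is the print-only row theorem `sh02_d73` again.
-/

namespace Summit.Ventures.AbcShadow

/-- `(0, 0)` is a point of order `2` on `G_{w,v}` (admissible `w`, prime `ℓ ∤ 2·73`), so `2 ∣ #G_{w,v}(𝔽_ℓ)`
(Mathlib `addOrderOf_dvd_natCard`). [folklore] -/
theorem two_dvd_natCard_bs23Frey {ℓ : ℕ} [Fact ℓ.Prime] (hℓ2 : ℓ ≠ 2) (hℓ73 : ℓ ≠ 73) (w : ZMod ℓ) (v : ℕ)
    (hw : w ^ 2 - (73 : ZMod ℓ) ^ (2 * v + 1) ≠ 0) : 2 ∣ Nat.card (bs23Frey 73 w v).toAffine.Point := by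
  have hΔ := delta_bs23Frey_ne_zero hℓ2 hℓ73 w v hw
  have heq : (bs23Frey 73 w v).toAffine.Equation 0 0 :=
    (equation_iff_rhs (bs23Frey 73 w v) rfl rfl 0 0).mpr (by simp [rhs, bs23Frey])
  have hns : (bs23Frey 73 w v).toAffine.Nonsingular 0 0 :=
    (WeierstrassCurve.Affine.equation_iff_nonsingular_of_Δ_ne_zero hΔ).mp heq
  let P : (bs23Frey 73 w v).toAffine.Point := .some 0 0 hns
  have hneg : (0 : ZMod ℓ) = (bs23Frey 73 w v).toAffine.negY 0 0 := by
    simp [WeierstrassCurve.Affine.negY, bs23Frey]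
  have h2 : (2 : ℕ) • P = 0 := by
    rw [two_nsmul]
    exact WeierstrassCurve.Affine.Point.add_self_of_Y_eq hneg
  have hP0 : P ≠ 0 := WeierstrassCurve.Affine.Point.some_ne_zero hns
  have hord : addOrderOf P = 2 := addOrderOf_eq_prime h2 hP0
  rw [← hord]
  exact addOrderOf_dvd_natCard P

/-- Hence `a_ℓ(G_{w,v})` is even for an odd prime `ℓ ∤ 73` and admissible `w`. [folklore] -/
theorem even_apTrace_bs23Frey {ℓ : ℕ} [Fact ℓ.Prime] (hℓ2 : ℓ ≠ 2) (hℓ73 : ℓ ≠ 73) (w : ZMod ℓ) (v : ℕ)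
    (hw : w ^ 2 - (73 : ZMod ℓ) ^ (2 * v + 1) ≠ 0) : Even (apTrace ℓ (bs23Frey 73 w v)) := by
  obtain ⟨m, hm⟩ := two_dvd_natCard_bs23Frey hℓ2 hℓ73 w v hw
  obtain ⟨r, hr⟩ := (Fact.out : ℓ.Prime).odd_of_ne_two hℓ2
  refine ⟨(r : ℤ) + 1 - m, ?_⟩
  unfold apTrace
  rw [hm, hr]
  push_cast
  ring

/-- **The transcribed record at `ℓ = 7841` holds**: `KillData7841` (traces `−158`; `S_7841 ⊆ {even, |t| ≤ 176} ∖ {−158}`).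
[folklore] -/
theorem killData_7841 : KillData7841 := by
  haveI : Fact (Nat.Prime 7841) := ⟨prime_7841⟩
  refine ⟨apTrace_e2336a1_7841, apTrace_e2336b1_7841, fun a ha => ?_⟩
  obtain ⟨w, hw, rfl⟩ := ha
  obtain ⟨-, -, -, -, -, -, hS⟩ := killCert_7841
  have hne := (hS _ ⟨w, hw, rfl⟩).1
  have heven := even_apTrace_bs23Frey (by decide) (by decide) w 1 hw
  have hsq := apTrace_sq_le (bs23Frey 73 w 1) (delta_bs23Frey_ne_zero (by decide) (by decide) w 1 hw)
  refine ⟨heven, ?_, hne⟩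
  obtain ⟨m, hm⟩ := heven
  have h178 : |apTrace 7841 (bs23Frey 73 w 1)| < 178 :=
    abs_lt_of_sq_lt_sq (by push_cast at hsq ⊢; linarith) (by norm_num)
  rw [abs_lt] at h178
  rw [abs_le]
  push_cast
  omega

/-- **The transcribed record at `ℓ = 41189` holds**: `KillData41189` (traces `−284`; `S_41189 ⊆ {even, |t| ≤ 404} ∖
{−284}`). [folklore] -/
theorem killData_41189 : KillData41189 := by
  haveI : Fact (Nat.Prime 41189) := ⟨prime_41189⟩
  refine ⟨apTrace_e2336a1_41189, apTrace_e2336b1_41189, fun a ha => ?_⟩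
  obtain ⟨w, hw, rfl⟩ := ha
  obtain ⟨-, -, -, -, -, -, hS⟩ := killCert_41189
  have hne := (hS _ ⟨w, hw, rfl⟩).1
  have heven := even_apTrace_bs23Frey (by decide) (by decide) w 0 hw
  have hsq := apTrace_sq_le (bs23Frey 73 w 0) (delta_bs23Frey_ne_zero (by decide) (by decide) w 0 hw)
  refine ⟨heven, ?_, hne⟩
  obtain ⟨m, hm⟩ := heven
  have h406 : |apTrace 41189 (bs23Frey 73 w 0)| < 406 :=
    abs_lt_of_sq_lt_sq (by push_cast at hsq ⊢; linarith) (by norm_num)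
  rw [abs_lt] at h406
  rw [abs_le]
  push_cast
  omega

/-- Both transcribed data hypotheses of `sh02_d73_of_data` hold, for the record (so `sh02_d73_of_data M hP
killData_7841 killData_41189 : D73`, the same statement as `sh02_d73`). [folklore] -/
theorem killData_hold : KillData7841 ∧ KillData41189 :=
  ⟨killData_7841, killData_41189⟩

end Summit.Ventures.AbcShadow
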